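import Mathlib.RingTheory.Regular.RegularSequence
import Literature.RingTheory.TightClosure.TightClosure
import Summits.ResolutionOfSingularities.ResolutionOfSingularities.Theorems.FrobeniusLadderFRationalModificationExchange
import Summits.ResolutionOfSingularities.ResolutionOfSingularities.Theorems.FrobeniusLadderFRationalModificationPowerLift
import HarnessLib

/-!
# Moving one parameter of a Frobenius closed parameter ideal (crux `FInjectiveMacaulayfication`)

Support file for crux stmt-ResolutionOfSingularities-15315 (`FrobeniusLadder.FInjectiveMacaulayfication`,
line `Sketch`): the Frobenius-closure analogues (witness `c = 1`, no domain hypothesis) of the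
tight-closure lemmas `PowerLift.stub_powerLift` and `Exchange.stub_exchange` landed for the sibling
crux `FRationalModification`.

Let `(R, 𝔪)` be a local ring of prime characteristic `p` and dimension `d + 1` which is
Cohen–Macaulay in the sense of the route (every system of parameters is a weakly regular sequence, in
the given order), and let `(a, u)` (`u : Fin d → R`, `rad (a, u) = 𝔪`) be a parameter ideal that is
FROBENIUS CLOSED (`x^q ∈ (a, u)^[q] ⇒ x ∈ (a, u)`, `q = p^e`). Then

* `isFrobeniusClosed_span_insert_pow` — `(aᵏ, u)` is Frobenius closed for every `k ≥ 1`
  (Fedder–Watanabe 1989, proof of Prop. 2.2, with `c = 1`: for `y = α a + β`, colon capturing along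
  the system of parameters `u^q, a^q` gives `α ∈ (aᵏ, u)^F`);
* `isFrobeniusClosed_exchange` — if `a ∈ (b, u)` then `(b, u)` is Frobenius closed (one-generator
  linkage: `β (b, u) ⊆ (a, u)` where `a = β b + z`, and `β` is regular modulo `(u)` because `a` is);
* `isFrobeniusClosed_move` — consequently (Noetherian `R`) EVERY parameter ideal `(b, u)` sharing the
  `d` parameters `u` with `(a, u)` is Frobenius closed (`aᴺ ∈ (b, u)` by cofinality; lift, exchange).

This is the one-coordinate step of "one Frobenius closed parameter ideal ⇒ all" for Cohen–Macaulay
local rings (Fedder 1983: F-injectivity; the all-coordinates statement is assembled in the sibling file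
`…OneParameterIdeal`), which in turn completes the no-go for parameter-ideal blow-up centres
(`…ParameterCentreNoGo`). Vocabulary: `Literature.RingTheory.TightClosure` (`frobeniusPower`,
`frobeniusClosure`, `IsFrobeniusClosed`, `IsSystemOfParameters`); colon capturing is
`Exchange.mem_span_of_mul_mem`. No named facts, no domain hypothesis.

## References

* [FedderWatanabe1989] R. Fedder, K.-i. Watanabe, *A characterization of F-regularity in terms of
  F-purity*, MSRI Publ. 15 (1989), proof of Prop. 2.2.
* [Fedder1983] R. Fedder, *F-purity and rational singularity*, Trans. AMS 278 (1983).
-/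

-- single-problem summit: the doubled namespace component `ResolutionOfSingularities` is forced
set_option linter.dupNamespace false

namespace Summit.ResolutionOfSingularities.ResolutionOfSingularities.Theorems.FInjectiveMacaulayfication.Move

open IsLocalRing RingTheory.Sequence Literature.RingTheory.TightClosure
open Summit.ResolutionOfSingularities.ResolutionOfSingularities.Theorems.FRationalModification

variable {R : Type*} [CommRing R]

/-! ## Raising one parameter to a power -/

/-- **Inductive step**: if `(a, u)` and `(aᵏ, u)` are Frobenius closed then so is `(a^{k+1}, u)`.
For `y ∈ (a^{k+1}, u)^F ⊆ (a, u)^F = (a, u)` write `y = α a + β` (`β ∈ (u)`); then `α a ∈ (a^{k+1}, u)^F`,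
so for some `q = p^e`, `a^q (α^q - λ (aᵏ)^q) ∈ (u^q)` and colon capturing along the system of parameters
`u^q, a^q` gives `α^q ∈ (aᵏ, u)^[q]`, i.e. `α ∈ (aᵏ, u)^F = (aᵏ, u)` and `y ∈ (a^{k+1}, u)`.
[cite: FedderWatanabe1989, proof of Prop. 2.2] -/
theorem isFrobeniusClosed_span_insert_pow_succ (p : ℕ) [Fact p.Prime] [IsLocalRing R] [CharP R p]
    (hCM : ∀ ⦃n : ℕ⦄ (s : Fin n → R), IsSystemOfParameters s → IsWeaklyRegular R (List.ofFn s))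
    {d : ℕ} (hd : ringKrullDim R = ((d + 1 : ℕ) : WithBot ℕ∞)) {a : R} {u : Fin d → R}
    (hau : (Ideal.span (insert a (Set.range u))).radical = maximalIdeal R)
    (hfc : IsFrobeniusClosed p (Ideal.span (insert a (Set.range u)))) {k : ℕ}
    (ih : IsFrobeniusClosed p (Ideal.span (insert (a ^ k) (Set.range u)))) :
    IsFrobeniusClosed p (Ideal.span (insert (a ^ (k + 1)) (Set.range u))) := by
  have hp : p ≠ 0 := (Fact.out : p.Prime).ne_zero
  set U : Ideal R := Ideal.span (Set.range u)
  have hU1 : U ≤ Ideal.span (insert a (Set.range u)) := Ideal.span_mono (Set.subset_insert _ _)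
  have hUk1 : U ≤ Ideal.span (insert (a ^ (k + 1)) (Set.range u)) :=
    Ideal.span_mono (Set.subset_insert _ _)
  have hk1_le : Ideal.span (insert (a ^ (k + 1)) (Set.range u)) ≤
      Ideal.span (insert a (Set.range u)) := by
    refine Ideal.span_le.mpr (Set.insert_subset ?_ (Ideal.subset_span.trans hU1))
    exact Ideal.pow_mem_of_mem _ (Ideal.subset_span (Set.mem_insert _ _)) _ (Nat.succ_pos k)
  refine (isFrobeniusClosed_iff_le p).mpr fun y hy => ?_
  -- `y ∈ (a, u)`: `y = α a + β`, `β ∈ (u)`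
  have hy1 : y ∈ Ideal.span (insert a (Set.range u)) :=
    ((isFrobeniusClosed_iff_le p).mp hfc) (frobeniusClosure_mono p hk1_le hy)
  obtain ⟨α, β, hβ, rfl⟩ := Ideal.mem_span_insert.mp hy1
  -- `α a ∈ (a^{k+1}, u)^F`, with exponent `e`
  have hαa : α * a ∈ frobeniusClosure p (Ideal.span (insert (a ^ (k + 1)) (Set.range u))) :=
    (Submodule.add_mem_iff_left _ (le_frobeniusClosure p _ (hUk1 hβ))).mp hy
  obtain ⟨e, he⟩ := (mem_frobeniusClosure_iff p).mp hαa
  -- `α ∈ (a^k, u)^F`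
  have hα : α ∈ frobeniusClosure p (Ideal.span (insert (a ^ k) (Set.range u))) := by
    refine (mem_frobeniusClosure_iff p).mpr ⟨e, ?_⟩
    rw [PowerLift.frobeniusPower_span_insert_range] at he ⊢
    rw [mul_pow] at he
    obtain ⟨lam, v, hv, heq⟩ := Ideal.mem_span_insert.mp he
    -- `a^q (α^q - lam (a^k)^q) = v ∈ (u^q)`
    have hmul : a ^ p ^ e * (α ^ p ^ e - lam * (a ^ k) ^ p ^ e) ∈
        Ideal.span (Set.range fun i => u i ^ p ^ e) := by
      have h : a ^ p ^ e * (α ^ p ^ e - lam * (a ^ k) ^ p ^ e) = v := by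
        rw [eq_sub_of_add_eq' heq.symm]
        ring
      rw [h]
      exact hv
    -- the parameter ideal `(a^q, u^q) = (a, u)^[q]` has radical `𝔪`
    have hrad : (Ideal.span (insert (a ^ p ^ e) (Set.range fun i => u i ^ p ^ e))).radical =
        maximalIdeal R := by
      rw [← PowerLift.frobeniusPower_span_insert_range p e a u,
        PowerLift.radical_frobeniusPower (pow_ne_zero e hp), hau]
    have hcap := Exchange.mem_span_of_mul_mem hCM hd hrad hmul
    exact Ideal.mem_span_insert.mpr ⟨lam, _, hcap, by ring⟩
  -- `α ∈ (a^k, u)`, so `α a + β ∈ (a^{k+1}, u)`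
  obtain ⟨μ, ν, hν, hαeq⟩ := Ideal.mem_span_insert.mp (((isFrobeniusClosed_iff_le p).mp ih) hα)
  refine Ideal.mem_span_insert.mpr ⟨μ, ν * a + β, add_mem (Ideal.mul_mem_right _ _ hν) hβ, ?_⟩
  rw [hαeq]
  ring

/-- **Raising one parameter to a power keeps the parameter ideal Frobenius closed**: with `R`
Cohen–Macaulay local of characteristic `p` and dimension `d + 1` as above, if `(a, u)` (`rad = 𝔪`) is
Frobenius closed then so is `(aᵏ, u)` for every `k ≥ 1`. [cite: FedderWatanabe1989, proof of Prop. 2.2] -/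
theorem isFrobeniusClosed_span_insert_pow (p : ℕ) [Fact p.Prime] [IsLocalRing R] [CharP R p]
    (hCM : ∀ ⦃n : ℕ⦄ (s : Fin n → R), IsSystemOfParameters s → IsWeaklyRegular R (List.ofFn s))
    {d : ℕ} (hd : ringKrullDim R = ((d + 1 : ℕ) : WithBot ℕ∞)) {a : R} {u : Fin d → R}
    (hau : (Ideal.span (insert a (Set.range u))).radical = maximalIdeal R)
    (hfc : IsFrobeniusClosed p (Ideal.span (insert a (Set.range u)))) {k : ℕ} (hk : 0 < k) :
    IsFrobeniusClosed p (Ideal.span (insert (a ^ k) (Set.range u))) := by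
  induction k, hk using Nat.le_induction with
  | base => rw [pow_one]; exact hfc
  | succ k _ ih => exact isFrobeniusClosed_span_insert_pow_succ p hCM hd hau hfc ih

/-! ## Exchanging one parameter -/

/-- **Exchanging one parameter**: `(R, 𝔪)` local of characteristic `p` and dimension `d + 1`,
Cohen–Macaulay (every system of parameters weakly regular); if the parameter ideal `(a, u)`
(`rad (a, u) = 𝔪`) is Frobenius closed and `a ∈ (b, u)`, then `(b, u)` is Frobenius closed. Write
`a = β b + z`, `z ∈ (u)`; then `β · (b, u) ⊆ (a, u)`, so for `y ∈ (b, u)^F` one has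
`β y ∈ (a, u)^F = (a, u)`, `β y = λ a + z'`, `β (y - λ b) ∈ (u)`; and `β` is regular modulo `(u)` because
`a` is (`Exchange.mem_span_of_mul_mem`). [cite: FedderWatanabe1989, proof of Prop. 2.2] -/
theorem isFrobeniusClosed_exchange (p : ℕ) [Fact p.Prime] [IsLocalRing R] [CharP R p]
    (hCM : ∀ ⦃n : ℕ⦄ (s : Fin n → R), IsSystemOfParameters s → IsWeaklyRegular R (List.ofFn s))
    {d : ℕ} (hd : ringKrullDim R = ((d + 1 : ℕ) : WithBot ℕ∞)) {a b : R} {u : Fin d → R}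
    (ha : (Ideal.span (insert a (Set.range u))).radical = maximalIdeal R)
    (hab : a ∈ Ideal.span (insert b (Set.range u)))
    (hfc : IsFrobeniusClosed p (Ideal.span (insert a (Set.range u)))) :
    IsFrobeniusClosed p (Ideal.span (insert b (Set.range u))) := by
  have hUA : Ideal.span (Set.range u) ≤ Ideal.span (insert a (Set.range u)) :=
    Ideal.span_mono (Set.subset_insert _ _)
  have hUB : Ideal.span (Set.range u) ≤ Ideal.span (insert b (Set.range u)) :=
    Ideal.span_mono (Set.subset_insert _ _)
  have haA : a ∈ Ideal.span (insert a (Set.range u)) := Ideal.subset_span (Set.mem_insert _ _)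
  have hbB : b ∈ Ideal.span (insert b (Set.range u)) := Ideal.subset_span (Set.mem_insert _ _)
  -- `a = β b + z` with `z ∈ (u)`
  obtain ⟨β, z, hz, habz⟩ := Ideal.mem_span_insert.mp hab
  -- (1) `β · (b, u) ⊆ (a, u)`
  have hβB : ∀ w ∈ Ideal.span (insert b (Set.range u)),
      β * w ∈ Ideal.span (insert a (Set.range u)) := by
    intro w hw
    refine Exchange.mul_mem_of_forall_mem_span ?_ hw
    rintro x (rfl | ⟨i, rfl⟩)
    · have hβx : β * x = a - z := by rw [habz]; ring
      rw [hβx]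
      exact sub_mem haA (hUA hz)
    · exact Ideal.mul_mem_left _ _ (hUA (Ideal.subset_span ⟨i, rfl⟩))
  -- (2) `β` is a non-zero-divisor modulo `(u)`, because `a` is
  have hβU : ∀ x : R, β * x ∈ Ideal.span (Set.range u) → x ∈ Ideal.span (Set.range u) := by
    intro x hx
    refine Exchange.mem_span_of_mul_mem hCM hd ha ?_
    have hax : a * x = b * (β * x) + z * x := by rw [habz]; ring
    rw [hax]
    exact add_mem (Ideal.mul_mem_left _ _ hx) (Ideal.mul_mem_right _ _ hz)
  -- (3) `β · (b, u)^F ⊆ (a, u)^F = (a, u)`, and conclude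
  rw [isFrobeniusClosed_iff_le]
  intro y hy
  obtain ⟨e, he⟩ := (mem_frobeniusClosure_iff p).mp hy
  have hβy : β * y ∈ frobeniusClosure p (Ideal.span (insert a (Set.range u))) := by
    refine (mem_frobeniusClosure_iff p).mpr ⟨e, ?_⟩
    rw [mul_pow]
    rw [frobeniusPower_def] at he
    refine Exchange.mul_mem_of_forall_mem_span ?_ he
    rintro _ ⟨w, hw, rfl⟩
    show β ^ p ^ e * w ^ p ^ e ∈ _
    rw [← mul_pow]
    exact pow_mem_frobeniusPower (hβB w hw)
  obtain ⟨lam, z', hz', hlam⟩ :=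
    Ideal.mem_span_insert.mp (((isFrobeniusClosed_iff_le p).mp hfc) hβy)
  -- `β (y - λ b) = λ z + z' ∈ (u)`
  have hdiff : β * (y - lam * b) ∈ Ideal.span (Set.range u) := by
    have hβ' : β * (y - lam * b) = lam * z + z' := by
      rw [habz] at hlam
      linear_combination hlam
    rw [hβ']
    exact add_mem (Ideal.mul_mem_left _ _ hz) hz'
  have hy' : y = lam * b + (y - lam * b) := by ring
  rw [hy']
  exact add_mem (Ideal.mul_mem_left _ _ hbB) (hUB (hβU _ hdiff))

/-! ## Moving one parameter arbitrarily -/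

/-- **Moving one parameter**: `(R, 𝔪)` Noetherian local of characteristic `p` and dimension `d + 1`,
Cohen–Macaulay (every system of parameters weakly regular). If the parameter ideal `(a, u)` (`rad = 𝔪`)
is Frobenius closed, then EVERY parameter ideal `(b, u)` (`rad = 𝔪`) with the same `u` is Frobenius
closed: `aᴺ ∈ 𝔪ᴺ ⊆ (b, u)` for some `N ≥ 1`, `(aᴺ, u)` is Frobenius closed
(`isFrobeniusClosed_span_insert_pow`), exchange `aᴺ` for `b` (`isFrobeniusClosed_exchange`).
[cite: FedderWatanabe1989, proof of Prop. 2.2] -/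
theorem isFrobeniusClosed_move (p : ℕ) [Fact p.Prime] [IsNoetherianRing R] [IsLocalRing R]
    [CharP R p]
    (hCM : ∀ ⦃n : ℕ⦄ (s : Fin n → R), IsSystemOfParameters s → IsWeaklyRegular R (List.ofFn s))
    {d : ℕ} (hd : ringKrullDim R = ((d + 1 : ℕ) : WithBot ℕ∞)) {a b : R} {u : Fin d → R}
    (ha : (Ideal.span (insert a (Set.range u))).radical = maximalIdeal R)
    (hb : (Ideal.span (insert b (Set.range u))).radical = maximalIdeal R)
    (hfc : IsFrobeniusClosed p (Ideal.span (insert a (Set.range u)))) :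
    IsFrobeniusClosed p (Ideal.span (insert b (Set.range u))) := by
  have ham : a ∈ maximalIdeal R := by
    rw [← ha]; exact Ideal.le_radical (Ideal.subset_span (Set.mem_insert _ _))
  -- cofinality: `a^(N+1) ∈ 𝔪^(N+1) ⊆ (b, u)`
  obtain ⟨N, hN⟩ := Ideal.exists_pow_le_of_le_radical_of_fg hb.ge
    (IsNoetherian.noetherian (maximalIdeal R))
  have haN : a ^ (N + 1) ∈ Ideal.span (insert b (Set.range u)) :=
    ((Ideal.pow_le_pow_right (Nat.le_succ N)).trans hN) (Ideal.pow_mem_pow ham _)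
  have hfcN : IsFrobeniusClosed p (Ideal.span (insert (a ^ (N + 1)) (Set.range u))) :=
    isFrobeniusClosed_span_insert_pow p hCM hd ha hfc (Nat.succ_pos N)
  have haNrad : (Ideal.span (insert (a ^ (N + 1)) (Set.range u))).radical = maximalIdeal R := by
    have h1 : (Ideal.span (insert (a ^ (N + 1)) (Set.range u))).radical =
        (Ideal.span (insert a (Set.range u))).radical := by
      apply le_antisymm
      · refine Ideal.radical_mono (Ideal.span_le.mpr (Set.insert_subset ?_ ?_))
        · exact Ideal.pow_mem_of_mem _ (Ideal.subset_span (Set.mem_insert _ _)) _ (Nat.succ_pos N)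
        · exact (Set.subset_insert _ _).trans Ideal.subset_span
      · refine Ideal.radical_le_radical_iff.mpr (Ideal.span_le.mpr (Set.insert_subset ?_ ?_))
        · exact ⟨N + 1, Ideal.subset_span (Set.mem_insert _ _)⟩
        · exact (Set.subset_insert _ _).trans (Ideal.subset_span.trans Ideal.le_radical)
    rw [h1, ha]
  exact isFrobeniusClosed_exchange p hCM hd haNrad haN hfcN

/-! ## Registration-friendly restatement (all binders explicit) -/

/-- **Moving one parameter keeps a parameter ideal Frobenius closed** — `isFrobeniusClosed_move` with
every binder explicit (universe `0`): in a Noetherian local ring of prime characteristic `p` and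
dimension `d + 1` in which every system of parameters is weakly regular, if `(a, u)` and `(b, u)` are
parameter ideals and `(a, u)` is Frobenius closed then `(b, u)` is Frobenius closed.
[cite: FedderWatanabe1989, proof of Prop. 2.2] -/
theorem frobeniusClosed_move_sop : ∀ (p : ℕ) [Fact p.Prime] (R : Type) [CommRing R] [IsNoetherianRing R] [IsLocalRing R] [CharP R p], (∀ ⦃n : ℕ⦄ (s : Fin n → R), Literature.RingTheory.TightClosure.IsSystemOfParameters s → RingTheory.Sequence.IsWeaklyRegular R (List.ofFn s)) → ∀ (d : ℕ), ringKrullDim R = ((d + 1 : ℕ) : WithBot ℕ∞) → ∀ (a b : R) (u : Fin d → R), (Ideal.span (insert a (Set.range u))).radical = IsLocalRing.maximalIdeal R → (Ideal.span (insert b (Set.range u))).radical = IsLocalRing.maximalIdeal R → Literature.RingTheory.TightClosure.IsFrobeniusClosed p (Ideal.span (insert a (Set.range u))) → Literature.RingTheory.TightClosure.IsFrobeniusClosed p (Ideal.span (insert b (Set.range u))) :=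
  fun p _ _ _ _ _ _ hCM _ hd _ _ _ ha hb hfc => isFrobeniusClosed_move p hCM hd ha hb hfc

end Summit.ResolutionOfSingularities.ResolutionOfSingularities.Theorems.FInjectiveMacaulayfication.Move
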